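import Summits.BirchSwinnertonDyer.BirchSwinnertonDyer.Theses.EisensteinPrimes
import Summits.BirchSwinnertonDyer.Rank1Residual.X1.RankZeroGoodLatticeDisplay
import Literature.NumberTheory.EllipticCurves.KellerYin2024.CyclotomicMainConjecture
import HarnessLib

/-!
# Crux `MazurMCOnX1RankZero` (route `EisensteinPrimes`, rung K5, item stmt-BirchSwinnertonDyer-19035)
# from crux 2 `GoodLatticeBDPValue` and crux 6 `SchneiderOnX1TypeB`: THEOREM B of the cell, class-wide

HONEST FRAMING (cell `bsd-eis`, home `run/shared/lean/pub/bsd-eis/`, seat `bsd-eis-k5-c5`; FULL-BSD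
rank-≤1 programme, ladder row A3 = class X1 ∩ {r_an = 0}: good ANOMALOUS Eisenstein prime `p > 2`,
`E[p]` reducible, parity type A forced by the class clause). Nothing here closes the item and nothing
is booked; no label moves. Companion of `Theorems/EisensteinPrimesMazurMCOnX1RankZero.lean` (line
certificate `katoky`, residue exactness, §3 discharge from KY Thm. 4.2.1, §6 route H from the TYPED
display). This file records the strongest structural fact the seat found about crux 5 INSIDE the route:

**crux 5 `MazurMCOnX1RankZero` ⇐ crux 2 `GoodLatticeBDPValue` + crux 6 `SchneiderOnX1TypeB` +
published named facts** (`mazurMCOnX1RankZero_of_goodLatticeBDPValue_of_schneiderOnX1TypeB`); §2 the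
per-pair booking currency (good lattice + ONE Schneider-certified partner + crux 2's input); §3 the
direct PRE discharge from Keller–Yin v2 Thm. 3.0.10 as typed by the cell's typer seat
(`mazurMCOnX1RankZero_of_thm3010`, conditional on the unrefereed claim); §4 the consequence for the
route: the whole X1 conjunct `BSDpOnClassX1` of the K5 leaf from cruxes 2 and 6 + published facts.

`X1/RankZeroGoodLatticeDisplay.lean` (this seat) proves the sub-cell's swapped display at the good
lattice of every leaf pair from Keller–Yin's IMC2 at `𝟙` for the good lattice (`h308` = the body of
crux 2, `KellerYin2024.thm308_imc2_bdpValue_goodLattice_OPEN`, whose hypothesis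
`selmerCorank (E/K) = 1` is blind to which of `E`, `E^K` carries the rank) by the MIRROR of ky's
Theorem-A chain — (5.5) verbatim (`KellerYinGoodLattice.display55_at_goodLattice`), (5.6) with the
ranks exchanged (`X1/RankZeroGrossZagierTwist.lean`, using the minus-part height–index relation
`X1/RankZeroHeightIndex.lean`), the odd parts of `Ш`, Tamagawa and torsion under `K/ℚ` — and
deduces `BSD(E,p)` and Mazur's main conjecture at every X1 pair of analytic rank `0` given the
Schneider non-degeneracy on the rank-one TYPE-B twist (crux 6), Greenberg–Vatsal Thm. (1.3) there,
Bump–Friedberg–Hoffstein for the admissible field, Ribet's lemma for the good lattice (tree theorem)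
and Cassels. So A3 becomes CLASS-WIDE modulo the same preprint input (⋆) as A1 plus row C1
(Schneider), exactly as the cell's ROUTING v1.2 proposed ("A3 = Theorem B, NOT via a cyclotomic
main conjecture at type A"): Keller–Yin's cyclotomic Thm. 3.0.10 (GAP-located) is NOT used, and the
route's independent open inputs are {crux 2, crux 3, crux 4, crux 6}.

References: [KellerYin2024] Thm. 3.0.8 (IMC2), proof of Thm. 4.2.1; [CastellaGrossiLeeSkinner2022]
Thm. 5.3.1 and its proof, Thm. 5.1.1; [GreenbergVatsal2000] Thm. (1.3); [BumpFriedbergHoffstein1990];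
[Schneider1985]; [Wuthrich2014] Thm. 16; [GreenbergLNM1716] Thm. 4.1; [MilneADT2006] I.7.3;
HOME/bsd-eis-ky-MEMO-1.md §5.2 (Theorem B); HOME/TARGET.md §1.1.
-/

-- `Summit.BirchSwinnertonDyer.BirchSwinnertonDyer.…`: the summit and its single sub-problem share a name (D-0017 layout).
set_option linter.dupNamespace false
set_option autoImplicit false

noncomputable section

open scoped Classical

open WeierstrassCurve Literature.NumberTheory.EllipticCurves
  Literature.NumberTheory.EllipticCurves.ModularForms
  Literature.NumberTheory.EllipticCurves.Rank1Residual
  Summit.BirchSwinnertonDyer.BirchSwinnertonDyer.Theorems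
  Summit.BirchSwinnertonDyer.Rank1Residual.X1

namespace Summit.BirchSwinnertonDyer.BirchSwinnertonDyer.Theorems.EisensteinPrimesMazurMCOnX1RankZeroTheoremB

/-- **Crux 5 from crux 2 and crux 6 (Theorem B of the cell, class-wide, in the kernel).** Granted
crux 2 `GoodLatticeBDPValue` (`h2` = `KellerYin2024.thm308_imc2_bdpValue_goodLattice_OPEN`: KY v2
Thm. 3.0.8 (IMC2) at `𝟙` ∘ BDP for the good lattice, PREPRINT — row A1's one open input), crux 6
`SchneiderOnX1TypeB` (`h6`: non-degeneracy of the canonical `p`-adic height on X1 type B, rank one),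
and the PUBLISHED named facts [CGLS] Thm. 5.1.1 as proved (`h511`), Cassels (`hCassels`),
Bump–Friedberg–Hoffstein (`hBFH`), Greenberg–Vatsal 2000 Thm. (1.3) (`hGV`), Perrin-Riou–Schneider
(`hS`), Perrin-Riou 1987 (`hPR`), modularity (`hmodP`, `hmod`), Gross–Zagier over `K` (`hGZ`),
Kolyvagin (`hKo`), Gross–Zagier–Kolyvagin (`hGZK`), Wuthrich 2014 Thm. 16 (`hW16`), Greenberg 1999
Thm. 4.1 (`hGr`): Mazur's main conjecture at every X1 pair of analytic rank `0` — the route decl by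
name (`X1.RankZeroGoodLatticeDisplay.Leaf.mazurMainConjecture_of_h308_of_schneiderOnTypeB`). Chain per
leaf pair: Ribet's lemma gives the good lattice `E'` in the class; BFH an admissible `K` with
`ord L(E'^K) = 1`; the twist is X1 type B rank one, so GV + `h6` + Perrin-Riou–Schneider give
`BSD(E'^K,p)`; `h2` + control + GZ + BDP + Kolyvagin give the swapped display, hence `BSD(E',p)`;
Cassels gives `BSD(E,p)`; the converse chain gives the main conjecture. All Eisenstein inputs are
ANTICYCLOTOMIC (KY Thm. 3.0.8) — KY's cyclotomic Thm. 3.0.10 is not used.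
[cite: KellerYin2024, Thm. 3.0.8 (IMC2) and proof of Thm. 4.2.1 (display; roles of E and E^K exchanged)]
[cite: GreenbergVatsal2000, Thm. (1.3)] [cite: CastellaGrossiLeeSkinner2022, Thm. 5.3.1 and its proof, Thm. 5.1.1]
[cite: Wuthrich2014, Thm. 16 (p. 397)] [cite: GreenbergLNM1716, Thm. 4.1] [cite: Schneider1985, §1] -/
theorem mazurMCOnX1RankZero_of_goodLatticeBDPValue_of_schneiderOnX1TypeB
    (h2 : Summit.BirchSwinnertonDyer.BirchSwinnertonDyer.Theses.EisensteinPrimes.GoodLatticeBDPValue)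
    (h6 : Summit.BirchSwinnertonDyer.BirchSwinnertonDyer.Theses.EisensteinPrimes.SchneiderOnX1TypeB)
    (h511 : CastellaGrossiLeeSkinner2022.thm511_anticyclotomicControl_of_torsionFree)
    (hCassels : bsdRHS_eq_of_isIsogenous)
    (hBFH : bumpFriedbergHoffstein_exists_heegnerField_split_twist_simpleZero)
    (hGV : GreenbergVatsal2000.thm13_charIdeal_eq_of_gvPar)
    (hS : Schneider1985_order_charGenerator_odd) (hPR : perrinRiou_rankOne_leadingTerms_odd)
    (hmodP : nonempty_modularParametrizationData) (hmod : exists_isNewformOf)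
    (hGZ : ∀ (N : ℕ) [NeZero N] (W : WeierstrassCurve ℚ) (K : Type) [Field K] [NumberField K],
      gross_zagier N W K)
    (hKo : ∀ (N : ℕ) [NeZero N] (W : WeierstrassCurve ℚ) (K : Type) [Field K] [NumberField K],
      kolyvagin N W K)
    (hGZK : rank_eq_analyticRank_of_analyticRank_le_one)
    (hW16 : Wuthrich2014.charIdeal_dvd_padicLFunction) (hGr : greenberg_charValue_rankZero) :
    Summit.BirchSwinnertonDyer.BirchSwinnertonDyer.Theses.EisensteinPrimes.MazurMCOnX1RankZero := by
  intro W _ _ p _ hX1 hr0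
  exact RankZeroGoodLatticeDisplay.Leaf.mazurMainConjecture_of_h308_of_schneiderOnTypeB h2 h511 h6
    hCassels hBFH hGV hS hPR hmodP hmod hGZ hKo hGZK hW16 hGr W ⟨hX1, hr0⟩

/-- **`BSD(E,p)` at every X1 pair of analytic rank `0` from crux 2 + crux 6 + published facts**
(the sub-cell statement `X1.RankZero.Statement` along Theorem B; the `BSDp` form the route's assembly
`bsdp_of_classX1_of_analyticRank_eq_zero` consumes through crux 5). Same inputs without the converse
chain's `hW16`, `hGr`. [cite: KellerYin2024, Thm. 3.0.8 (IMC2)] [cite: GreenbergVatsal2000, Thm. (1.3)]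
[cite: CastellaGrossiLeeSkinner2022, Thm. 5.3.1 and its proof] -/
theorem statement_of_goodLatticeBDPValue_of_schneiderOnX1TypeB
    (h2 : Summit.BirchSwinnertonDyer.BirchSwinnertonDyer.Theses.EisensteinPrimes.GoodLatticeBDPValue)
    (h6 : Summit.BirchSwinnertonDyer.BirchSwinnertonDyer.Theses.EisensteinPrimes.SchneiderOnX1TypeB)
    (h511 : CastellaGrossiLeeSkinner2022.thm511_anticyclotomicControl_of_torsionFree)
    (hCassels : bsdRHS_eq_of_isIsogenous)
    (hBFH : bumpFriedbergHoffstein_exists_heegnerField_split_twist_simpleZero)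
    (hGV : GreenbergVatsal2000.thm13_charIdeal_eq_of_gvPar)
    (hS : Schneider1985_order_charGenerator_odd) (hPR : perrinRiou_rankOne_leadingTerms_odd)
    (hmodP : nonempty_modularParametrizationData) (hmod : exists_isNewformOf)
    (hGZ : ∀ (N : ℕ) [NeZero N] (W : WeierstrassCurve ℚ) (K : Type) [Field K] [NumberField K],
      gross_zagier N W K)
    (hKo : ∀ (N : ℕ) [NeZero N] (W : WeierstrassCurve ℚ) (K : Type) [Field K] [NumberField K],
      kolyvagin N W K)
    (hGZK : rank_eq_analyticRank_of_analyticRank_le_one) : RankZero.Statement :=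
  fun W _ _ _ _ hL ↦ RankZeroGoodLatticeDisplay.Leaf.bsdp_of_h308_of_schneiderOnTypeB h2 h511 h6
    hCassels hBFH hGV hS hPR hmodP hmod hGZ hKo hGZK W hL

/-! ## §2. Per pair (the booking currency of row A3): the good lattice + ONE Schneider-certified
partner + crux 2's input -/

/-- **Per-pair form at the GOOD LATTICE: `BSD(E',p)` from `h308` and ONE Schneider-certified admissible
partner.** For a leaf pair `(E',p)` (X1, `r_an = 0`) whose curve is KY's good lattice (`hGL`: no
rational `p`-line unramified at `p`) and an admissible `K` with a globally minimal model `Wd` of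
`E'^{(d_K)}` of analytic rank one passing the Schneider certificate (`hW4 : SchneiderPartnerAt W p` —
per pair a finite `p`-adic computation, the cell's row C1 instrument), granted crux 2's input `h2`
(KY Thm. 3.0.8 (IMC2) at `𝟙`, PRE) and the PUBLISHED facts: Miller's `BSD(E',p)`. The display at
`(E', p, K, Wd)` is DERIVED (`X1.RankZeroGoodLatticeDisplay.displaySwap_at_goodLattice`), not assumed.
[cite: KellerYin2024, Thm. 3.0.8 (IMC2)] [cite: GreenbergVatsal2000, Thm. (1.3)] [cite: Schneider1985, §1]
[cite: CastellaGrossiLeeSkinner2022, Thm. 5.3.1 and its proof] -/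
theorem bsdp_goodLattice_of_goodLatticeBDPValue_of_schneiderPartnerAt
    (h2 : Summit.BirchSwinnertonDyer.BirchSwinnertonDyer.Theses.EisensteinPrimes.GoodLatticeBDPValue)
    (h511 : CastellaGrossiLeeSkinner2022.thm511_anticyclotomicControl_of_torsionFree)
    (hGV : GreenbergVatsal2000.thm13_charIdeal_eq_of_gvPar)
    (hS : Schneider1985_order_charGenerator_odd) (hPR : perrinRiou_rankOne_leadingTerms_odd)
    (hmodP : nonempty_modularParametrizationData) (hmod : exists_isNewformOf)
    (hGZ : ∀ (N : ℕ) [NeZero N] (W : WeierstrassCurve ℚ) (K : Type) [Field K] [NumberField K],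
      gross_zagier N W K)
    (hKo : ∀ (N : ℕ) [NeZero N] (W : WeierstrassCurve ℚ) (K : Type) [Field K] [NumberField K],
      kolyvagin N W K)
    (hGZK : rank_eq_analyticRank_of_analyticRank_le_one)
    {p : ℕ} [Fact p.Prime] (W : WeierstrassCurve ℚ) [W.IsElliptic] [W.IsGloballyMinimal]
    (hL : RankZero.Leaf W p)
    (hGL : ∀ Φ : AddSubgroup (geomTorsion W (p : ℤ)), IsRationalLine W p Φ → ¬ LineUnramifiedAt W p Φ)
    (hW4 : RankZeroPartner.SchneiderPartnerAt W p) : BSDp W p := by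
  have hpP : p.Prime := Fact.out
  obtain ⟨hp, hred, hgood, han, -⟩ := hL.classX1
  have hp2 : p ≠ 2 := by omega
  have hmod' : hasEntireLFunction_rat := hasEntireLFunction_rat_of_exists_isNewformOf hmod
  obtain ⟨K, _, _, hK, hodd, hlt, hHN, hHp, Wd, _, _, ⟨C, hC⟩, hrd, hSchd⟩ := hW4
  have hdneg : NumberField.discr K < 0 := IsImaginaryQuadratic.discr_neg hK
  have hsq : Squarefree (NumberField.discr K) := squarefree_discr_of_odd hK hodd
  have hpd : ¬ (p : ℤ) ∣ NumberField.discr K := not_dvd_discr_of_split hK hpP hp2 hHp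
  have hBd : BSDp Wd p :=
    RankZeroPartner.bsdp_partner_of_analyticRank_eq_one hGV hS hPR
      PadicSigmaThree.mazur_tate_sigma_exists_odd_holds hmodP hGZK hL hdneg hsq hpd Wd C hC hrd hSchd
  have hMD := RankZeroPartner.exists_rat_entireLFunction_one_div_realPeriodRat hmodP W
  exact Rank1ResidualX1RankZeroTwist.bsdp_rankZero_of_displaySwap_of_bsdp_twist hmod' hGZK W p
    hL.analyticRank_eq_zero hMD Wd (by omega) hBd
    (RankZeroGoodLatticeDisplay.displaySwap_at_goodLattice h2 h511 hmodP hGZ hKo hGZK hmod' W hp hgood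
      hred han hGL hL.analyticRank_eq_zero K hK hodd hlt hHN hHp Wd ⟨C, hC⟩ hrd)

/-- **Per-pair form for ANY leaf pair**: `BSD(E,p)` for a leaf pair `(E,p)` from an ISOGENOUS good
lattice `E'` carrying ONE Schneider-certified admissible partner (`hW4`), crux 2's input `h2` and the
PUBLISHED facts (+ Cassels `hCassels` for the transport back; the good lattice of the class exists by
the tree's Ribet-lemma theorem `GoodLatticeExists.exists_isIsogenous_noUnramifiedLine`). This is the
census currency of row A3: (⋆) [PRE] · Schneider on the good lattice's rank-one twist [CERT per pair] ·
[PUB]. [cite: KellerYin2024, Thm. 3.0.8 (IMC2), Prop. 1.3.1] [cite: MilneADT2006, Thm. I.7.3] -/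
theorem bsdp_of_isIsogenous_goodLattice_of_goodLatticeBDPValue_of_schneiderPartnerAt
    (h2 : Summit.BirchSwinnertonDyer.BirchSwinnertonDyer.Theses.EisensteinPrimes.GoodLatticeBDPValue)
    (h511 : CastellaGrossiLeeSkinner2022.thm511_anticyclotomicControl_of_torsionFree)
    (hCassels : bsdRHS_eq_of_isIsogenous)
    (hGV : GreenbergVatsal2000.thm13_charIdeal_eq_of_gvPar)
    (hS : Schneider1985_order_charGenerator_odd) (hPR : perrinRiou_rankOne_leadingTerms_odd)
    (hmodP : nonempty_modularParametrizationData) (hmod : exists_isNewformOf)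
    (hGZ : ∀ (N : ℕ) [NeZero N] (W : WeierstrassCurve ℚ) (K : Type) [Field K] [NumberField K],
      gross_zagier N W K)
    (hKo : ∀ (N : ℕ) [NeZero N] (W : WeierstrassCurve ℚ) (K : Type) [Field K] [NumberField K],
      kolyvagin N W K)
    (hGZK : rank_eq_analyticRank_of_analyticRank_le_one)
    {p : ℕ} [Fact p.Prime] (V : WeierstrassCurve ℚ) [V.IsElliptic] [V.IsGloballyMinimal]
    (hL : RankZero.Leaf V p)
    (W : WeierstrassCurve ℚ) [W.IsElliptic] [W.IsGloballyMinimal] (hiso : IsIsogenous V W)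
    (hGL : ∀ Φ : AddSubgroup (geomTorsion W (p : ℤ)), IsRationalLine W p Φ → ¬ LineUnramifiedAt W p Φ)
    (hW4 : RankZeroPartner.SchneiderPartnerAt W p) : BSDp V p := by
  have hX1' : ClassX1 W p := ClassX1.of_isIsogenous hiso hL.classX1
  have hr' : W.analyticRank = 0 :=
    (analyticRank_eq_of_isIsogenous' hiso).symm.trans hL.analyticRank_eq_zero
  have hB' : BSDp W p := bsdp_goodLattice_of_goodLatticeBDPValue_of_schneiderPartnerAt h2 h511 hGV hS
    hPR hmodP hmod hGZ hKo hGZK W ⟨hX1', hr'⟩ hGL hW4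
  obtain ⟨-, hfin'⟩ := hGZK W (by omega)
  have hlead' : W.leadingLCoeff ≠ 0 :=
    WeierstrassCurve.leadingLCoeff_ne_zero_holds (hasEntireLFunction_rat_of_exists_isNewformOf hmod W)
  exact Wuthrich2014.bsdp_of_isIsogenous hCassels hiso hfin' hlead' hB'

/-- **Per pair, Mazur's main conjecture** at a leaf pair from the same data (+ Wuthrich Thm. 16
`hW16`, Greenberg Thm. 4.1 `hGr` for the converse chain). [cite: Wuthrich2014, Thm. 16 (p. 397)]
[cite: GreenbergLNM1716, Thm. 4.1] [cite: KellerYin2024, Thm. 3.0.8 (IMC2)] -/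
theorem mazurMainConjecture_of_isIsogenous_goodLattice_of_goodLatticeBDPValue_of_schneiderPartnerAt
    (h2 : Summit.BirchSwinnertonDyer.BirchSwinnertonDyer.Theses.EisensteinPrimes.GoodLatticeBDPValue)
    (h511 : CastellaGrossiLeeSkinner2022.thm511_anticyclotomicControl_of_torsionFree)
    (hCassels : bsdRHS_eq_of_isIsogenous)
    (hGV : GreenbergVatsal2000.thm13_charIdeal_eq_of_gvPar)
    (hS : Schneider1985_order_charGenerator_odd) (hPR : perrinRiou_rankOne_leadingTerms_odd)
    (hmodP : nonempty_modularParametrizationData) (hmod : exists_isNewformOf)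
    (hGZ : ∀ (N : ℕ) [NeZero N] (W : WeierstrassCurve ℚ) (K : Type) [Field K] [NumberField K],
      gross_zagier N W K)
    (hKo : ∀ (N : ℕ) [NeZero N] (W : WeierstrassCurve ℚ) (K : Type) [Field K] [NumberField K],
      kolyvagin N W K)
    (hGZK : rank_eq_analyticRank_of_analyticRank_le_one)
    (hW16 : Wuthrich2014.charIdeal_dvd_padicLFunction) (hGr : greenberg_charValue_rankZero)
    {p : ℕ} [Fact p.Prime] (V : WeierstrassCurve ℚ) [V.IsElliptic] [V.IsGloballyMinimal]
    (hL : RankZero.Leaf V p)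
    (W : WeierstrassCurve ℚ) [W.IsElliptic] [W.IsGloballyMinimal] (hiso : IsIsogenous V W)
    (hGL : ∀ Φ : AddSubgroup (geomTorsion W (p : ℤ)), IsRationalLine W p Φ → ¬ LineUnramifiedAt W p Φ)
    (hW4 : RankZeroPartner.SchneiderPartnerAt W p) : Rank1ResidualX1Defs.MazurMainConjecture V p :=
  (RankZero.Leaf.mazurMainConjecture_iff_bsdp hW16 hGr hmodP hGZK hL).mpr
    (bsdp_of_isIsogenous_goodLattice_of_goodLatticeBDPValue_of_schneiderPartnerAt h2 h511 hCassels hGV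
      hS hPR hmodP hmod hGZ hKo hGZK V hL W hiso hGL hW4)

/-! ## §3. The direct preprint discharge: Keller–Yin v2 Thm. 3.0.10 as typed by the cell's typer
(`KellerYin2024.thm3010_charIdeal_eq_padicLFunction_OPEN`, p418095) -/

/-- **Crux 5 from Keller–Yin v2 Thm. 3.0.10 (PREPRINT, typed).** The tree's named preprint statement
`KellerYin2024.thm3010_charIdeal_eq_padicLFunction_OPEN` (`h3010`: "Let `E/ℚ` be an elliptic curve, and
let `p > 2` be a prime of good reduction for `E`. Suppose that `p` is Eisenstein. Then …
`Char_{Λ_ℚ}(𝔛_ord(E/ℚ_∞)) = 𝓛_p^{MSD}(E/ℚ)`" — `[claim: KellerYin2024, under-review]`; its two-sentence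
proof is read by the cell as GAP-located at the anomalous Kolyvagin step, ky MEMO-1 §5 C1–C4) is,
binder for binder, Mazur's main conjecture in the tree's normalisation at every good Eisenstein `p > 2`;
an X1 pair is such a pair (`2 < p`, `Good`, `Red` are the first three clauses of `ClassX1`). So the
crux follows by restriction — CONDITIONAL on the unrefereed claim; the item does not close by it. This
is the registered stub `stub_muLambda` of line `katoky` plus Kato, asserted outright.
[cite: KellerYin2024, Thm. 3.0.10 (v2, unlabeled, TeX L1651–1659; claim, under review)] -/
theorem mazurMCOnX1RankZero_of_thm3010
    (h3010 : KellerYin2024.thm3010_charIdeal_eq_padicLFunction_OPEN) :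
    Summit.BirchSwinnertonDyer.BirchSwinnertonDyer.Theses.EisensteinPrimes.MazurMCOnX1RankZero :=
  fun W _ _ p _ hX1 _ ↦ h3010 W p hX1.1 hX1.2.2.1 hX1.2.1

/-! ## §4. Consequence for the route: the WHOLE X1 conjunct of the K5 leaf from crux 2 + crux 6 -/

/-- **`BSDpOnClassX1` (Miller's `BSD(E,p)` at every X1 pair of analytic rank `≤ 1`) from crux 2
`GoodLatticeBDPValue`, crux 6 `SchneiderOnX1TypeB` and the published record.** Rank `0`: Theorem B
class-wide (this file's §1 through `X1.RankZeroGoodLatticeDisplay.Leaf.bsdp_of_h308_of_schneiderOnTypeB`);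
rank `1`, type B: Greenberg–Vatsal + crux 6 + Perrin-Riou–Schneider (`X1.bsdp_of_typeBRankOne_of_schneider`,
`σ`-existence proved); rank `1`, type A: ky's Theorem A on the class
(`X1.KellerYinTheoremA.forall_bsdp_classX1_typeA_rankOne`, crux 2 + PUB). So the X1 half of the
rung-K5 leaf `EisensteinPrimes` rests on TWO open items of the route (cruxes 2 and 6) and published
facts: the assembly's binder `hMC0` (= crux 5) is supplied by cruxes 2 and 6. PUBLISHED inputs by
name: `h511` (CGLS 5.1.1 as proved), `hCassels`, `hBFH` (Bump–Friedberg–Hoffstein), `hGV` (GV Thm. 1.3),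
`hGr` (Greenberg Thm. 4.1), `hmodP`/`hmod` (modularity), `hHL` (Hoffstein–Luo), `hGZQ` (Gross–Zagier
I.7.3), `hGZ` (Gross–Zagier over `K`), `hKo` (Kolyvagin), `hGZK`, `hS` (Perrin-Riou–Schneider), `hPR`
(Perrin-Riou 1987). [cite: KellerYin2024, Thm. 3.0.8 (IMC2) and Thm. 4.2.1 (claim, under review)]
[cite: GreenbergVatsal2000, Thm. (1.3)] [cite: CastellaGrossiLeeSkinner2022, Thm. 5.3.1 and its proof]
[cite: Schneider1985, §1] -/
theorem bsdpOnClassX1_of_goodLatticeBDPValue_of_schneiderOnX1TypeB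
    (h2 : Summit.BirchSwinnertonDyer.BirchSwinnertonDyer.Theses.EisensteinPrimes.GoodLatticeBDPValue)
    (h6 : Summit.BirchSwinnertonDyer.BirchSwinnertonDyer.Theses.EisensteinPrimes.SchneiderOnX1TypeB)
    (h511 : CastellaGrossiLeeSkinner2022.thm511_anticyclotomicControl_of_torsionFree)
    (hCassels : bsdRHS_eq_of_isIsogenous)
    (hBFH : bumpFriedbergHoffstein_exists_heegnerField_split_twist_simpleZero)
    (hGV : GreenbergVatsal2000.thm13_charIdeal_eq_of_gvPar) (hGr : greenberg_charValue_rankZero)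
    (hmodP : nonempty_modularParametrizationData) (hmod : exists_isNewformOf)
    (hHL : HoffsteinLuo1997_exists_twist_L_one_ne_zero) (hGZQ : GrossZagier1986_thm_I_7_3)
    (hGZ : ∀ (N : ℕ) [NeZero N] (W : WeierstrassCurve ℚ) (K : Type) [Field K] [NumberField K],
      gross_zagier N W K)
    (hKo : ∀ (N : ℕ) [NeZero N] (W : WeierstrassCurve ℚ) (K : Type) [Field K] [NumberField K],
      kolyvagin N W K)
    (hGZK : rank_eq_analyticRank_of_analyticRank_le_one)
    (hS : Schneider1985_order_charGenerator_odd) (hPR : perrinRiou_rankOne_leadingTerms_odd) :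
    Rank1ResidualX1Defs.BSDpOnClassX1 := by
  intro W _ _ p _ hX1 hr
  rcases Nat.le_one_iff_eq_zero_or_eq_one.mp hr with h0 | hr1
  · exact RankZeroGoodLatticeDisplay.Leaf.bsdp_of_h308_of_schneiderOnTypeB h2 h511 h6 hCassels hBFH hGV
      hS hPR hmodP hmod hGZ hKo hGZK W ⟨hX1, h0⟩
  · by_cases hgv : GVPar W p
    · exact bsdp_of_typeBRankOne_of_schneider hGV hS hPR PadicSigmaThree.mazur_tate_sigma_exists_odd_holds
        hmodP hGZK W p ⟨hX1, hr1, hgv⟩ (h6 W p ⟨hX1, hr1, hgv⟩)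
    · exact KellerYinTheoremA.forall_bsdp_classX1_typeA_rankOne h2 h511 hCassels hGV hGr hmodP hmod hHL
        hGZQ hGZ hKo hGZK W p hX1 hgv hr1

end Summit.BirchSwinnertonDyer.BirchSwinnertonDyer.Theorems.EisensteinPrimesMazurMCOnX1RankZeroTheoremB

end
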